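import Summits.CriticalPhenomena.PercolationContinuityZ3.Theorems.PercNearOneGluingNoHeavyLowerTailBlockLonelyRelay
import HarnessLib

/-!
# `NoHeavyLowerTail` (stmt-CriticalPhenomena-4575), one-cut line — the block lonely relay lemma WITH ITS
# SATURATION FACTOR: a level of disjoint candidate pockets carries its full budget `t` only if the observer
# still reaches the blocks when ALL blocks are mutually separated

Support file (factory prove seat `prim-ineq-prove-3`, gen 2; `--supports stmt-CriticalPhenomena-4575`).
Bookkeeping only: no definitions, no named facts, no sorries.

Notation: `μ = prodBernoulli w` on `Fin n`, observer `o`, relays `A`, a family `𝓑` of pairwise disjoint blocks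
`B ⊆ A`; `E_B = {o ↔ B}` (`o` joined to some vertex of `B`), `D_B = {B ↮ A ∖ B}`,
`M = ⋂_{B ∈ 𝓑} D_B` (every block separated from its complement in `A`), `t ≥ μ(D_B)` for all `B ∈ 𝓑`.

The tree's `Theorems.blockLonelyRelay` (Kozma–Nitzan Lemma 2 with general blocks) reads
`Σ_{B ∈ 𝓑} μ(E_B ∩ D_B) ≤ t`.  Its proof gives more, and this file records the sharper form:

* `blockLonelyRelay_mul_sep` — **`(Σ_{B ∈ 𝓑} μ(E_B ∩ D_B)) · μ(M) ≤ t · μ({o ↔ ⋃𝓑} ∩ M)`**, unconditionally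
  (no positivity or weight-continuity needed: it is a product inequality);
* `blockLonelyRelay_condSep` — when `μ(M) > 0`:  `Σ_{B ∈ 𝓑} μ(E_B ∩ D_B) ≤ t · μ({o ↔ ⋃𝓑} ∩ M) / μ(M)`,
  i.e. `≤ t · P(o ↔ ⋃𝓑 ∣ M)`;
* `disjointClusters_sum_mul_sep` — the same for the captured relay set:
  `(Σ_{B ∈ 𝓑} P(C(o) ∩ A = B)) · μ(M) ≤ t · μ({o ↔ ⋃𝓑} ∩ M)`.

WHY IT IS RECORDED (the `log |A|` gap of the one-cut line, cf. `Theorems.oneCut_logLoss`, `Theorems.fingerInv_log`):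
the entropy-free calculus in the tree (lonely relay = antichain bound, common core = chain bound, pair counting,
disjoint-pocket products) is consistent with a dyadic laminar profile of candidate pockets in which EVERY dyadic
level carries pocket mass `t` (total `t · log₂ |A|`).  By the present lemma a level `𝓑` can carry mass close to
`t` only if `P(o ↔ ⋃𝓑 ∣ M_𝓑)` is close to `1`: the observer must still reach the blocks of that level when all of
them are mutually separated — simultaneously at every saturated level.  This is the quantitative form of the
remark "a saturated antichain forces a one-layer-like observer", and is the handle by which the observer's own
structure (not only the law of `C(o) ∩ A`) enters the missing `log`-removal step.
-/

namespace Summit.CriticalPhenomena.PercolationContinuityZ3.Theorems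

open scoped BigOperators Classical
open MeasureTheory Set
open Literature.Probability.LatticeModels (prodBernoulli)
open Literature.Probability.Percolation

variable {n : ℕ}

open BlockLonelyRelay in
/-- **Block lonely relay lemma with its saturation factor (product form).**  For `μ = prodBernoulli w`, an
observer `o`, relays `A`, pairwise disjoint blocks `B ⊆ A` (`B ∈ 𝓑`) with `μ(B ↮ A∖B) ≤ t`, and
`M = {every block separated from its complement}`:
`(Σ_{B ∈ 𝓑} μ({o ↔ B} ∩ {B ↮ A∖B})) · μ(M) ≤ t · μ({o ↔ ⋃𝓑} ∩ M)`.
Proof: block terminal separation (`blockTerminalSeparation`, KN Lemma 1(i) by gluing) termwise with `T = A∖B` and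
`Q_B` = "the other blocks are separated from the rest" (`D_B ∩ Q_B = M`), then the events `{o ↔ B} ∩ M` are
pairwise disjoint and their union is `{o ↔ ⋃𝓑} ∩ M`.
[cite: KozmaNitzan2024, Lemma 2 (p. 6); VandenbergHaggstromKahn2005, Thm. 1.3] -/
theorem blockLonelyRelay_mul_sep (w : Sym2 (Fin n) → unitInterval) (A : Finset (Fin n)) (o : Fin n)
    (𝓑 : Finset (Finset (Fin n))) (hsub : ∀ B ∈ 𝓑, B ⊆ A)
    (hdisj : ∀ B' ∈ 𝓑, ∀ B'' ∈ 𝓑, B' ≠ B'' → Disjoint B' B'') (t : ℝ)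
    (hq : ∀ B ∈ 𝓑, (prodBernoulli w).real {ω | ∀ b ∈ B, ∀ a ∈ A \ B, ω ∉ openConn b a} ≤ t) :
    (∑ B ∈ 𝓑, (prodBernoulli w).real ({ω | ∃ b ∈ B, ω ∈ openConn o b} ∩
        {ω | ∀ b ∈ B, ∀ a ∈ A \ B, ω ∉ openConn b a})) *
      (prodBernoulli w).real {ω | ∀ B' ∈ 𝓑, ∀ b ∈ B', ∀ a ∈ A \ B', ω ∉ openConn b a} ≤
    t * (prodBernoulli w).real ({ω | ∃ B ∈ 𝓑, ∃ b ∈ B, ω ∈ openConn o b} ∩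
        {ω | ∀ B' ∈ 𝓑, ∀ b ∈ B', ∀ a ∈ A \ B', ω ∉ openConn b a}) := by
  set μ := prodBernoulli w with hμ
  set M : Set (BondConfig (Fin n)) :=
    {ω | ∀ B' ∈ 𝓑, ∀ b ∈ B', ∀ a ∈ A \ B', ω ∉ openConn b a} with hMdef
  -- termwise: block terminal separation with `T = A \ B`, `Q = Q_B`
  have h2 : ∀ B ∈ 𝓑,
      μ.real ({ω | ∃ b ∈ B, ω ∈ openConn o b} ∩ {ω | ∀ b ∈ B, ∀ a ∈ A \ B, ω ∉ openConn b a}) *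
          μ.real M ≤
        t * μ.real ({ω | ∃ b ∈ B, ω ∈ openConn o b} ∩ M) := by
    intro B hB
    have hP : ∀ p ∈ (𝓑.erase B).biUnion (fun B' => B' ×ˢ (A \ (B' ∪ B))), p.1 ∈ A \ B := by
      intro p hp
      obtain ⟨B', hB', hne, h1, _, _, _⟩ := mem_pairs_iff.1 hp
      exact Finset.mem_sdiff.2 ⟨hsub B' hB' h1,
        fun h => (Finset.disjoint_left.1 (hdisj B' hB' B hB hne)) h1 h⟩
    have key := blockTerminalSeparation w B (A \ B) o _ hP
    rw [sep_inter_pairs_eq hB hsub hdisj] at key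
    calc μ.real ({ω | ∃ b ∈ B, ω ∈ openConn o b} ∩ {ω | ∀ b ∈ B, ∀ a ∈ A \ B, ω ∉ openConn b a}) *
          μ.real M
        ≤ μ.real {ω | ∀ b ∈ B, ∀ a ∈ A \ B, ω ∉ openConn b a} *
            μ.real ({ω | ∃ b ∈ B, ω ∈ openConn o b} ∩ M) := key
      _ ≤ t * μ.real ({ω | ∃ b ∈ B, ω ∈ openConn o b} ∩ M) :=
          mul_le_mul_of_nonneg_right (hq B hB) measureReal_nonneg
  -- `t ≥ 0` as soon as `𝓑` is nonempty (it bounds a probability); the empty case is trivial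
  by_cases hne : 𝓑 = ∅
  · subst hne
    simp
  obtain ⟨B₀, hB₀⟩ := Finset.nonempty_iff_ne_empty.2 hne
  have ht : 0 ≤ t := le_trans measureReal_nonneg (hq B₀ hB₀)
  -- disjointness: the events `{o ↔ B} ∩ M` are pairwise disjoint with union `{o ↔ ⋃𝓑} ∩ M`
  have h3 : ∑ B ∈ 𝓑, μ.real ({ω | ∃ b ∈ B, ω ∈ openConn o b} ∩ M) =
      μ.real ({ω | ∃ B ∈ 𝓑, ∃ b ∈ B, ω ∈ openConn o b} ∩ M) := by
    rw [← measureReal_biUnion_finset (pairwiseDisjoint_join_inter 𝓑 o hsub hdisj)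
      (fun B _ => MeasurableSet.of_discrete)]
    congr 1
    ext ω
    simp only [mem_iUnion, mem_inter_iff, mem_setOf_eq, exists_prop]
    constructor
    · rintro ⟨B, hB, ⟨b, hb, hob⟩, hM⟩
      exact ⟨⟨B, hB, b, hb, hob⟩, hM⟩
    · rintro ⟨⟨B, hB, b, hb, hob⟩, hM⟩
      exact ⟨B, hB, ⟨b, hb, hob⟩, hM⟩
  rw [Finset.sum_mul]
  calc ∑ B ∈ 𝓑, μ.real ({ω | ∃ b ∈ B, ω ∈ openConn o b} ∩
          {ω | ∀ b ∈ B, ∀ a ∈ A \ B, ω ∉ openConn b a}) * μ.real M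
      ≤ ∑ B ∈ 𝓑, t * μ.real ({ω | ∃ b ∈ B, ω ∈ openConn o b} ∩ M) := Finset.sum_le_sum h2
    _ = t * ∑ B ∈ 𝓑, μ.real ({ω | ∃ b ∈ B, ω ∈ openConn o b} ∩ M) := (Finset.mul_sum _ _ _).symm
    _ = t * μ.real ({ω | ∃ B ∈ 𝓑, ∃ b ∈ B, ω ∈ openConn o b} ∩ M) := by rw [h3]

/-- **Block lonely relay lemma, conditional form.**  When `μ(M) > 0` (e.g. all weights `< 1`):
`Σ_{B ∈ 𝓑} μ({o ↔ B} ∩ {B ↮ A∖B}) ≤ t · μ({o ↔ ⋃𝓑} ∩ M) / μ(M) = t · P(o ↔ ⋃𝓑 ∣ M)`.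
Since the conditional probability is `≤ 1` this contains `Theorems.blockLonelyRelay` (for positive `μ(M)`), and
it says that a family of disjoint blocks can carry pocket mass close to `t` only if the observer reaches the
blocks with conditional probability close to `1` given that all blocks are mutually separated.
[cite: KozmaNitzan2024, Lemma 2 (p. 6)] -/
theorem blockLonelyRelay_condSep (w : Sym2 (Fin n) → unitInterval) (A : Finset (Fin n)) (o : Fin n)
    (𝓑 : Finset (Finset (Fin n))) (hsub : ∀ B ∈ 𝓑, B ⊆ A)
    (hdisj : ∀ B' ∈ 𝓑, ∀ B'' ∈ 𝓑, B' ≠ B'' → Disjoint B' B'') (t : ℝ)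
    (hq : ∀ B ∈ 𝓑, (prodBernoulli w).real {ω | ∀ b ∈ B, ∀ a ∈ A \ B, ω ∉ openConn b a} ≤ t)
    (hM : 0 < (prodBernoulli w).real {ω | ∀ B' ∈ 𝓑, ∀ b ∈ B', ∀ a ∈ A \ B', ω ∉ openConn b a}) :
    ∑ B ∈ 𝓑, (prodBernoulli w).real ({ω | ∃ b ∈ B, ω ∈ openConn o b} ∩
        {ω | ∀ b ∈ B, ∀ a ∈ A \ B, ω ∉ openConn b a}) ≤
    t * (prodBernoulli w).real ({ω | ∃ B ∈ 𝓑, ∃ b ∈ B, ω ∈ openConn o b} ∩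
        {ω | ∀ B' ∈ 𝓑, ∀ b ∈ B', ∀ a ∈ A \ B', ω ∉ openConn b a}) /
      (prodBernoulli w).real {ω | ∀ B' ∈ 𝓑, ∀ b ∈ B', ∀ a ∈ A \ B', ω ∉ openConn b a} := by
  rw [le_div_iff₀ hM]
  exact blockLonelyRelay_mul_sep w A o 𝓑 hsub hdisj t hq

/-- **Saturation factor for the captured relay set.**  For pairwise disjoint nonempty blocks `B ⊆ A` with
`μ(B ↮ A∖B) ≤ t`: `(Σ_{B ∈ 𝓑} μ(C(o) ∩ A = B)) · μ(M) ≤ t · μ({o ↔ ⋃𝓑} ∩ M)`, where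
`{C(o) ∩ A = B} = {∀ a ∈ A, o ↔ a ↔ a ∈ B}` (contained in `{o ↔ B} ∩ {B ↮ A∖B}` for nonempty `B`).
[cite: KozmaNitzan2024, Lemma 2 (p. 6) — corollary] -/
theorem disjointClusters_sum_mul_sep (w : Sym2 (Fin n) → unitInterval) (A : Finset (Fin n)) (o : Fin n)
    (𝓑 : Finset (Finset (Fin n))) (hsub : ∀ B ∈ 𝓑, B ⊆ A) (hne : ∀ B ∈ 𝓑, B.Nonempty)
    (hdisj : ∀ B' ∈ 𝓑, ∀ B'' ∈ 𝓑, B' ≠ B'' → Disjoint B' B'') (t : ℝ)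
    (hq : ∀ B ∈ 𝓑, (prodBernoulli w).real {ω | ∀ b ∈ B, ∀ a ∈ A \ B, ω ∉ openConn b a} ≤ t) :
    (∑ B ∈ 𝓑, (prodBernoulli w).real
        {ω : BondConfig (Fin n) | ∀ a ∈ A, ω ∈ openConn o a ↔ a ∈ B}) *
      (prodBernoulli w).real {ω | ∀ B' ∈ 𝓑, ∀ b ∈ B', ∀ a ∈ A \ B', ω ∉ openConn b a} ≤
    t * (prodBernoulli w).real ({ω | ∃ B ∈ 𝓑, ∃ b ∈ B, ω ∈ openConn o b} ∩
        {ω | ∀ B' ∈ 𝓑, ∀ b ∈ B', ∀ a ∈ A \ B', ω ∉ openConn b a}) := by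
  have hmono : ∑ B ∈ 𝓑, (prodBernoulli w).real
        {ω : BondConfig (Fin n) | ∀ a ∈ A, ω ∈ openConn o a ↔ a ∈ B} ≤
      ∑ B ∈ 𝓑, (prodBernoulli w).real ({ω | ∃ b ∈ B, ω ∈ openConn o b} ∩
        {ω | ∀ b ∈ B, ∀ a ∈ A \ B, ω ∉ openConn b a}) := by
    refine Finset.sum_le_sum fun B hB => measureReal_mono ?_
    intro ω hω
    simp only [mem_setOf_eq] at hω
    obtain ⟨b, hb⟩ := hne B hB
    refine ⟨⟨b, hb, (hω b (hsub B hB hb)).2 hb⟩, fun b' hb' a ha hba => ?_⟩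
    obtain ⟨haA, haB⟩ := Finset.mem_sdiff.1 ha
    have hob' : (openGraph ω).Reachable o b' := (hω b' (hsub B hB hb')).2 hb'
    exact haB ((hω a haA).1 (hob'.trans hba))
  exact le_trans (mul_le_mul_of_nonneg_right hmono measureReal_nonneg)
    (blockLonelyRelay_mul_sep w A o 𝓑 hsub hdisj t hq)

end Summit.CriticalPhenomena.PercolationContinuityZ3.Theorems
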